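import Summits.CriticalPhenomena.PercolationContinuityZ3.Theorems.PercNearOneGluingNoHeavyLowerTailSunflowerMultiPetalModuleLift
import HarnessLib
import HarnessLib.Audit

/-!
# `NoHeavyLowerTail` (crux stmt-CriticalPhenomena-4575), abstract sunflower cubic, `k` petals: the INTERSECTING-MODULE (AND-block) REDUCTION of ★ₖ

Support file (seat `prim-l12-p2` gen 33; `--supports stmt-CriticalPhenomena-4575`; companion of `…SunflowerMultiPetalModule` (p358966: `IsModule`, `pat`, `gsum`,
`ZK_eq_sum_pattern`) and `…SunflowerMultiPetalModuleLift` (this gen: `gsum_swap12/23`)).  Everything here is PROVED; no `sorry`.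
Memo: run/shared/lean/prim/prim-l12/prim-l12-p2/FINDING-g33-MODULE-LIFT.md §1.6.

MODULE INDUCTION MODULO ONE COEFFICIENT (memo §1.6).  For a module `(M, g)` of `F` the module identity reads `ZK = Σ_P N(P)·C(P)`; the lifted sums with `#P = 1` are
(one third of) the partition functional of the QUOTIENT (the structure with `M` collapsed to one point), `C(∅)` that of the deletion window, `C({0,1,2})` that of the
contraction, and the `#P = 2` sums are the single-flip coefficient of the quotient.  If the gadget is INTERSECTING (never fires on two disjoint subsets of `M`:
AND-blocks / series legs, majorities, …) then `N(P) = 0` for `#P ≥ 2` (`card_filter_pat_eq_zero_of_intersecting`), so: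
* **`ZK_nonneg_of_isModule_of_intersecting`**: ★ₖ for `F` follows from `0 ≤ gsum Mᶜ ∅ ∅ ∅` (deletion window) and `0 ≤ gsum Mᶜ M ∅ ∅` (quotient) alone;
* `ZK_nonneg_of_isModule_and`: the AND-block case `g T = (T = M)`.
Together with the non-bottom and petal-completing module reductions (`…ModuleLift`, `…FlipSingleton`): a minimal counterexample to ★ₖ has only BOTTOM modules with
two disjoint firing sets (OR-like legs), whose quotient point is white with a negative single-flip coefficient.
-/

namespace Summit.CriticalPhenomena.PercolationContinuityZ3.Theorems.SunflowerPartition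

open Finset

variable {α : Type*} [DecidableEq α]

namespace MSunflower

variable {k : ℕ} (F : MSunflower k α)

/-! ## Modules whose gadget never fires on two disjoint blocks (INTERSECTING gadgets: AND-blocks, majorities, …) -/

/-- For an intersecting gadget (no two disjoint subsets of `M` both fire) no trace has a firing pattern with two or more blocks. [this work] -/
theorem card_filter_pat_eq_zero_of_intersecting {M : Finset α} {g : Finset α → Bool}
    (hg : ∀ S T : Finset α, S ⊆ M → T ⊆ M → Disjoint S T → g S = true → g T = true → False)
    (P : Finset (Fin 3)) (hP : 2 ≤ P.card) : ((partsOf M).filter fun s => pat M g s = P).card = 0 := by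
  rw [Finset.card_eq_zero, Finset.filter_eq_empty_iff]
  intro s hs hsP
  obtain ⟨h1, h2, hd⟩ := (Sunflower.mem_partsOf_iff).1 hs
  have h3 : M \ (s.1 ∪ s.2) ⊆ M := sdiff_subset
  have d13 : Disjoint s.1 (M \ (s.1 ∪ s.2)) := disjoint_sdiff_self_right.mono_right (sdiff_subset_sdiff (subset_refl M) subset_union_left)
  have d23 : Disjoint s.2 (M \ (s.1 ∪ s.2)) := disjoint_sdiff_self_right.mono_right (sdiff_subset_sdiff (subset_refl M) subset_union_right)
  have p0 : ((0 : Fin 3) ∈ pat M g s) = (g s.1 = true) := by unfold pat; simp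
  have p1 : ((1 : Fin 3) ∈ pat M g s) = (g s.2 = true) := by unfold pat; simp
  have p2 : ((2 : Fin 3) ∈ pat M g s) = (g (M \ (s.1 ∪ s.2)) = true) := by unfold pat; simp
  rw [← hsP] at hP
  -- at most one block fires, so the pattern has at most one element
  by_cases b0 : g s.1 = true <;> by_cases b1 : g s.2 = true <;> by_cases b2 : g (M \ (s.1 ∪ s.2)) = true
  · exact hg _ _ h1 h2 hd b0 b1
  · exact hg _ _ h1 h2 hd b0 b1
  · exact hg _ _ h1 h3 d13 b0 b2
  · have hsub : pat M g s ⊆ {0} := by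
      intro j hj
      fin_cases j
      · exact mem_singleton_self _
      · exact absurd (p1 ▸ hj) b1
      · exact absurd (p2 ▸ hj) b2
    have := (card_le_card hsub).trans (card_singleton (0 : Fin 3)).le
    omega
  · exact hg _ _ h2 h3 d23 b1 b2
  · have hsub : pat M g s ⊆ {1} := by
      intro j hj
      fin_cases j
      · exact absurd (p0 ▸ hj) b0
      · exact mem_singleton_self _
      · exact absurd (p2 ▸ hj) b2
    have := (card_le_card hsub).trans (card_singleton (1 : Fin 3)).le
    omega
  · have hsub : pat M g s ⊆ {2} := by
      intro j hj
      fin_cases j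
      · exact absurd (p0 ▸ hj) b0
      · exact absurd (p1 ▸ hj) b1
      · exact mem_singleton_self _
    have := (card_le_card hsub).trans (card_singleton (2 : Fin 3)).le
    omega
  · have hsub : pat M g s ⊆ (∅ : Finset (Fin 3)) := by
      intro j hj
      fin_cases j
      · exact absurd (p0 ▸ hj) b0
      · exact absurd (p1 ▸ hj) b1
      · exact absurd (p2 ▸ hj) b2
    have := (card_le_card hsub).trans (card_empty).le
    omega

/-- **INTERSECTING-MODULE REDUCTION** (module induction modulo one coefficient, the coefficient being absent): if `(M, g)` is a module of `F` whose gadget never fires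
on two disjoint subsets of `M`, then ★ₖ for `F` follows from ★ₖ of the deletion window (`0 ≤ gsum Mᶜ ∅ ∅ ∅`) and of the quotient (`0 ≤ gsum Mᶜ M ∅ ∅`, one third of the
partition functional of the structure with `M` collapsed to a point) — no flipped coefficient and no contraction is needed. [this work] -/
theorem ZK_nonneg_of_isModule_of_intersecting [Fintype α] {M : Finset α} {g : Finset α → Bool} (hF : F.IsModule M g)
    (hg : ∀ S T : Finset α, S ⊆ M → T ⊆ M → Disjoint S T → g S = true → g T = true → False)
    (h0 : 0 ≤ F.gsum Mᶜ ∅ ∅ ∅) (h1 : 0 ≤ F.gsum Mᶜ M ∅ ∅) : 0 ≤ F.ZK := by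
  rw [F.ZK_eq_sum_pattern hF]
  refine sum_nonneg fun P _ => ?_
  unfold modCoef glue
  have two : ∀ {Q : Finset (Fin 3)} (i j : Fin 3), i ≠ j → i ∈ Q → j ∈ Q → 2 ≤ Q.card := by
    intro Q i j hij hi hj
    have hsub : ({i, j} : Finset (Fin 3)) ⊆ Q := by
      intro x hx
      rcases mem_insert.1 hx with h | h
      · exact h ▸ hi
      · exact (mem_singleton.1 h) ▸ hj
    have hc : ({i, j} : Finset (Fin 3)).card = 2 := card_pair hij
    exact hc ▸ card_le_card hsub
  by_cases a0 : (0 : Fin 3) ∈ P <;> by_cases a1 : (1 : Fin 3) ∈ P <;> by_cases a2 : (2 : Fin 3) ∈ P <;>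
    simp only [a0, a1, a2, if_true, if_false]
  · rw [card_filter_pat_eq_zero_of_intersecting hg P (two 0 1 (by decide) a0 a1)]; simp
  · rw [card_filter_pat_eq_zero_of_intersecting hg P (two 0 1 (by decide) a0 a1)]; simp
  · rw [card_filter_pat_eq_zero_of_intersecting hg P (two 0 2 (by decide) a0 a2)]; simp
  · exact mul_nonneg (by exact_mod_cast Nat.zero_le _) h1
  · rw [card_filter_pat_eq_zero_of_intersecting hg P (two 1 2 (by decide) a1 a2)]; simp
  · refine mul_nonneg (by exact_mod_cast Nat.zero_le _) ?_
    rw [F.gsum_swap12 Mᶜ ∅ M ∅]; exact h1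
  · refine mul_nonneg (by exact_mod_cast Nat.zero_le _) ?_
    rw [F.gsum_swap23 Mᶜ ∅ ∅ M, F.gsum_swap12 Mᶜ ∅ M ∅]; exact h1
  · exact mul_nonneg (by exact_mod_cast Nat.zero_le _) h0

/-- **AND-MODULE (series block) REDUCTION**: if the nonempty set `M` is a module firing only when entirely present (`g T = (T = M)`), ★ₖ for `F` follows from ★ₖ of
the deletion window and of the quotient. [this work] -/
theorem ZK_nonneg_of_isModule_and [Fintype α] {M : Finset α} (hM : M.Nonempty) (hF : F.IsModule M (fun T => decide (T = M)))
    (h0 : 0 ≤ F.gsum Mᶜ ∅ ∅ ∅) (h1 : 0 ≤ F.gsum Mᶜ M ∅ ∅) : 0 ≤ F.ZK := by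
  refine F.ZK_nonneg_of_isModule_of_intersecting hF (fun S T hS _ hd gS gT => ?_) h0 h1
  have eS : S = M := of_decide_eq_true gS
  have eT : T = M := of_decide_eq_true gT
  subst eS; subst eT
  obtain ⟨x, hx⟩ := hM
  exact (Finset.disjoint_left.1 hd) hx hx

end MSunflower

end Summit.CriticalPhenomena.PercolationContinuityZ3.Theorems.SunflowerPartition
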